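import Mathlib.FieldTheory.Normal.Closure
import Mathlib.FieldTheory.Galois.Basic
import Mathlib.FieldTheory.PurelyInseparable.PerfectClosure
import Mathlib.FieldTheory.SeparableClosure
import Mathlib.FieldTheory.IsAlgClosed.AlgebraicClosure
import Mathlib.FieldTheory.Perfect
import Mathlib.RingTheory.DedekindDomain.IntegralClosure
import Literature.AlgebraicGeometry.Resolution.TateJapaneseCore
import HarnessLib

/-!
# Tate's theorem: `R` normal Noetherian, `x`-adically complete, `R/xR` an N-2 domain ⇒ `R` is N-2 (EGA 0_IV 23.1.3; Stacks 10.161.16)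

Topic: `Literature/AlgebraicGeometry/Resolution`. Completion of the proof of Stacks Lemma 10.161.16
(Tate) [EGA 0_IV (23.1.3)] from its purely inseparable core (`TateJapaneseCore.lean`), following the
printed reductions: *"If the characteristic of `K` is zero the lemma follows from (1), see Lemma
10.161.11"* (normal Noetherian domains have finite integral closure in separable extensions —
Mathlib's `IsIntegralClosure.finite`), and in characteristic `p`, Lemma 10.161.12: *"Choose a
finite normal field extension `M/K` containing `L`. … there exists a subextension `M/M_insep/K`
such that `M_insep/K` is purely inseparable, and `M/M_insep` is separable. By assumption the
integral closure `R'` of `R` in `M_insep` is finite over `R`. By Lemma 10.161.8 the integral closure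
`R''` of `R'` in `M` is finite over `R'`"*, together with *"By enlarging `L` if necessary we may
assume there exists an element `y ∈ L` such that `y^q = x`"*.

* `exists_purelyInseparable_separable_tower` — the field-theoretic input: for `L/K` finite of
  characteristic `p` and `c ∈ K` there are a finite extension `M ⊇ L` of `K`, an intermediate
  extension `K ⊆ E ⊆ M` and `Q = p^d` with `E^Q ⊆ K`, `c^{1/Q} ∈ E` and `M/E` separable (normal
  closure `M₀` of `L`, `E₀ =` fixed field of `Aut_K(M₀)` — `M₀/E₀` Galois by Artin, `E₀/K` purely
  inseparable because the roots of a minimal polynomial over `K` form one `Aut_K(M₀)`-orbit — then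
  `E = E₀(y)`, `M = M₀(y)` with `y^Q = c`);
* `module_finite_integralClosure_of_isAdicComplete_span` — **Tate's theorem**: under the
  hypotheses of `TateJapaneseCore.module_finite_integralClosure_of_pow_mem` on `(R, x)`, the
  integral closure of `R` in EVERY finite extension of `Frac R` is a finite `R`-module.

No definitions, no named facts. Step 3 of the discharge of
`EGAIV2_7_7_4_finiteNormalization_completeLocal` (`FiniteNormalizationCompleteLocalBase.lean`).

## References

* [StacksProject] The Stacks Project, Tag 0BI1 (Section 10.161): Lemmas 10.161.8, 10.161.11,
  10.161.12, 10.161.16.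
* [EGA0IV] A. Grothendieck, J. Dieudonné, EGA IV₁ (Chap. 0), Publ. Math. IHÉS 20 (1964), (23.1.3).
-/

noncomputable section

open scoped Pointwise nonZeroDivisors IntermediateField
open Polynomial

namespace Literature.AlgebraicGeometry.Resolution

universe u

/-! ## Field theory: a purely inseparable / separable tower through a `Q`-th root -/

/-- An element of a finite normal extension `M₀/K` (characteristic `p`) fixed by every
`K`-automorphism has its `p^{[M₀:K]}`-th power in `K` (the roots of its minimal polynomial form a
single `Aut_K(M₀)`-orbit, so it is purely inseparable over `K`, of exponent at most `[M₀ : K]`).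
[cite: StacksProject, Tag 0BI1 (Lemma 10.161.12, "`M_insep/K` is purely inseparable")] -/
theorem exists_algebraMap_eq_pow_of_forall_algEquiv_apply_eq {K M₀ : Type*} [Field K] [Field M₀]
    [Algebra K M₀] [FiniteDimensional K M₀] [Normal K M₀] (p : ℕ) [Fact p.Prime] [CharP K p]
    {z : M₀} (hz : ∀ σ : M₀ ≃ₐ[K] M₀, σ z = z) :
    ∃ k : K, algebraMap K M₀ k = z ^ p ^ Module.finrank K M₀ := by
  classical
  haveI : ExpChar K p := ExpChar.prime Fact.out
  have hzi : IsIntegral K z := Algebra.IsIntegral.isIntegral z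
  -- the minimal polynomial of `z` has exactly one root in `M₀`
  have hroots : ((minpoly K z).aroots M₀).toFinset = {z} := by
    ext w
    simp only [Multiset.mem_toFinset, Finset.mem_singleton]
    constructor
    · intro hw
      rw [mem_aroots] at hw
      have hmin : minpoly K w = minpoly K z :=
        (minpoly.eq_of_irreducible_of_monic (minpoly.irreducible hzi) hw.2 (minpoly.monic hzi)).symm
      obtain ⟨σ, hσ⟩ := (Normal.minpoly_eq_iff_mem_orbit M₀).mp hmin
      rw [← hσ]
      exact hz σ
    · rintro rfl
      exact mem_aroots.mpr ⟨minpoly.ne_zero hzi, minpoly.aeval K w⟩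
  have hsep : (minpoly K z).natSepDegree = 1 := by
    rw [natSepDegree_eq_of_splits (minpoly K z) (Normal.splits inferInstance z), hroots,
      Finset.card_singleton]
  haveI hpi : IsPurelyInseparable K K⟮z⟯ :=
    (IntermediateField.isPurelyInseparable_adjoin_simple_iff_natSepDegree_eq_one K M₀).mpr hsep
  -- the minimal polynomial is `X^(p^n) - y` with `p^n ≤ [M₀ : K]`
  obtain ⟨n, y, hny⟩ := IsPurelyInseparable.minpoly_eq_X_pow_sub_C K p
    (IntermediateField.AdjoinSimple.gen K z)
  rw [IntermediateField.minpoly_gen] at hny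
  have hdeg : p ^ n ≤ Module.finrank K M₀ := by
    have h1 := minpoly.natDegree_le (A := K) z
    rw [hny, natDegree_X_pow_sub_C] at h1
    exact h1
  have hzy : z ^ p ^ n = algebraMap K M₀ y := by
    have h2 := minpoly.aeval K z
    rw [hny, map_sub, aeval_X_pow, aeval_C, sub_eq_zero] at h2
    exact h2
  have hnle : n ≤ Module.finrank K M₀ :=
    le_trans (Nat.lt_pow_self (Fact.out : p.Prime).one_lt).le hdeg
  refine ⟨y ^ p ^ (Module.finrank K M₀ - n), ?_⟩
  rw [map_pow, ← hzy, ← pow_mul, ← pow_add, Nat.add_sub_cancel' hnle]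

/-- **The purely inseparable / separable tower through a `Q`-th root** (Stacks 10.161.12 with the
"enlarging `L`" step of 10.161.16): for a finite extension `L/K` of characteristic `p` and `c ∈ K`
there are a finite extension `M` of `K` receiving `L`, an intermediate extension `K ⊆ E ⊆ M` and a
`p`-power `Q` such that `E^Q ⊆ K`, `c` has a `Q`-th root in `E`, and `M/E` is separable.
Construction: `M₀` the normal closure of `L`, `E₀` the fixed field of `Aut_K(M₀)` (`M₀/E₀` is Galois
by Artin's theorem, `E₀/K` purely inseparable), `y` a `Q`-th root of `c` in an algebraic closure,
`E = E₀(y)`, `M = M₀(y)`. [cite: StacksProject, Tag 0BI1 (Lemmas 10.161.12 and 10.161.16)] -/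
theorem exists_purelyInseparable_separable_tower (K L : Type u) [Field K] [Field L] [Algebra K L]
    [FiniteDimensional K L] (p : ℕ) [Fact p.Prime] [CharP K p] (c : K) :
    ∃ (M E : Type u) (_ : Field M) (_ : Field E) (_ : Algebra K M) (_ : Algebra K E)
      (_ : Algebra E M) (_ : IsScalarTower K E M) (_ : FiniteDimensional K M)
      (_ : FiniteDimensional K E) (_ : L →ₐ[K] M) (Q : ℕ),
      0 < Q ∧ (∀ z : E, ∃ k : K, algebraMap K E k = z ^ Q) ∧
        (∃ y : E, y ^ Q = algebraMap K E c) ∧ Algebra.IsSeparable E M := by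
  classical
  haveI : ExpChar K p := ExpChar.prime Fact.out
  let Ω := AlgebraicClosure L
  haveI : CharP Ω p := charP_of_injective_algebraMap (algebraMap K Ω).injective p
  haveI : ExpChar Ω p := ExpChar.prime Fact.out
  -- the normal closure and the fixed field of its automorphism group
  let M₀ : IntermediateField K Ω := IntermediateField.normalClosure K L Ω
  let E₀ : IntermediateField K M₀ := IntermediateField.fixedField (⊤ : Subgroup (M₀ ≃ₐ[K] M₀))
  haveI hGal : IsGalois E₀ M₀ := IsGalois.of_fixed_field M₀ (⊤ : Subgroup (M₀ ≃ₐ[K] M₀))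
  let d := Module.finrank K M₀
  let Q := p ^ d
  have hQ : 0 < Q := pow_pos (Fact.out : p.Prime).pos d
  have hE₀ : ∀ z : M₀, z ∈ E₀ → ∃ k : K, algebraMap K Ω k = (z : Ω) ^ Q := by
    intro z hz
    have hz' : ∀ σ : M₀ ≃ₐ[K] M₀, σ z = z := fun σ =>
      (IntermediateField.mem_fixedField_iff ⊤ z).mp hz σ (Subgroup.mem_top σ)
    obtain ⟨k, hk⟩ := exists_algebraMap_eq_pow_of_forall_algEquiv_apply_eq p hz'
    refine ⟨k, ?_⟩
    have := congrArg (algebraMap M₀ Ω) hk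
    rw [← IsScalarTower.algebraMap_apply, map_pow] at this
    exact this
  -- a `Q`-th root of `c`
  obtain ⟨y, hy⟩ := IsAlgClosed.exists_pow_nat_eq (algebraMap K Ω c) hQ
  have hyint : IsIntegral K y := IsIntegral.of_pow hQ (by rw [hy]; exact isIntegral_algebraMap)
  -- the intermediate field of elements with `Q`-th power in `K`
  let T : IntermediateField K Ω :=
    { carrier := {z | ∃ k : K, algebraMap K Ω k = z ^ Q}
      mul_mem' := by
        rintro a b ⟨ka, ha⟩ ⟨kb, hb⟩
        exact ⟨ka * kb, by rw [map_mul, ha, hb, mul_pow]⟩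
      one_mem' := ⟨1, by rw [map_one, one_pow]⟩
      add_mem' := by
        rintro a b ⟨ka, ha⟩ ⟨kb, hb⟩
        exact ⟨ka + kb, by rw [map_add, ha, hb, add_pow_expChar_pow]⟩
      zero_mem' := ⟨0, by rw [map_zero, zero_pow hQ.ne']⟩
      algebraMap_mem' := fun k => ⟨k ^ Q, by rw [map_pow]⟩
      inv_mem' := by
        rintro a ⟨ka, ha⟩
        exact ⟨ka⁻¹, by rw [map_inv₀, ha, inv_pow]⟩ }
  -- `E = E₀(y)` and `M = M₀(y)` inside `Ω`
  let P : IntermediateField K Ω := E₀.map M₀.val ⊔ K⟮y⟯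
  let M : IntermediateField K Ω := M₀ ⊔ K⟮y⟯
  have hE₀M₀ : E₀.map M₀.val ≤ M₀ := by
    rintro _ ⟨z, -, rfl⟩; exact z.2
  have hPM : P ≤ M := sup_le_sup_right hE₀M₀ _
  have hPT : P ≤ T := by
    refine sup_le ?_ ?_
    · rintro _ ⟨z, hz, rfl⟩
      exact hE₀ z hz
    · rw [IntermediateField.adjoin_simple_le_iff]
      exact ⟨c, hy.symm⟩
  haveI : FiniteDimensional K K⟮y⟯ := IntermediateField.adjoin.finiteDimensional hyint
  haveI hMfd : FiniteDimensional K M := IntermediateField.finiteDimensional_sup M₀ K⟮y⟯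
  haveI hPfd : FiniteDimensional K P :=
    FiniteDimensional.of_injective (IntermediateField.inclusion hPM).toLinearMap
      (IntermediateField.inclusion_injective hPM)
  -- the algebra structures `E₀ → P → M → Ω`
  letI algPM : Algebra P M := (IntermediateField.inclusion hPM).toRingHom.toAlgebra
  haveI : IsScalarTower K P M := IsScalarTower.of_algebraMap_eq fun k => rfl
  haveI : IsScalarTower P M Ω := IsScalarTower.of_algebraMap_eq fun z => rfl
  have hf₀P : ∀ e : E₀, algebraMap E₀ Ω e ∈ P := fun e =>
    (le_sup_left : E₀.map M₀.val ≤ P) ⟨(e : M₀), e.2, rfl⟩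
  letI algE₀P : Algebra E₀ P := ((algebraMap E₀ Ω).codRestrict P hf₀P).toAlgebra
  haveI : IsScalarTower E₀ P Ω := IsScalarTower.of_algebraMap_eq fun e => rfl
  -- `M/P` is separable
  have hMsep : M ≤ (separableClosure P Ω).restrictScalars K := by
    refine sup_le ?_ ?_
    · intro s hs
      rw [IntermediateField.mem_restrictScalars, mem_separableClosure_iff]
      have h1 : IsSeparable E₀ (⟨s, hs⟩ : M₀) := Algebra.IsSeparable.isSeparable E₀ _
      have h2 : IsSeparable E₀ ((IsScalarTower.toAlgHom E₀ M₀ Ω) ⟨s, hs⟩) :=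
        IsSeparable.map (IsScalarTower.toAlgHom E₀ M₀ Ω) (RingHom.injective _) h1
      exact IsSeparable.tower_top P h2
    · rw [IntermediateField.adjoin_simple_le_iff, IntermediateField.mem_restrictScalars,
        mem_separableClosure_iff]
      have hyP : y ∈ P := (le_sup_right : K⟮y⟯ ≤ P) (IntermediateField.mem_adjoin_simple_self K y)
      have : y = algebraMap P Ω ⟨y, hyP⟩ := rfl
      rw [this]
      exact isSeparable_algebraMap _
  haveI hsepPM : Algebra.IsSeparable P M := by
    refine ⟨fun m => ?_⟩
    have hm : IsSeparable P (m : Ω) := by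
      have := hMsep m.2
      rw [IntermediateField.mem_restrictScalars, mem_separableClosure_iff] at this
      exact this
    exact IsSeparable.of_algHom (IsScalarTower.toAlgHom P M Ω) hm
  -- the embedding `L → M`
  have hLM : ∀ l : L, (IsScalarTower.toAlgHom K L Ω) l ∈ M := fun l =>
    (le_sup_left : M₀ ≤ M) ((IsScalarTower.toAlgHom K L Ω).fieldRange_le_normalClosure ⟨l, rfl⟩)
  let ι : L →ₐ[K] M := (IsScalarTower.toAlgHom K L Ω).codRestrict M.toSubalgebra hLM
  refine ⟨M, P, inferInstance, inferInstance, inferInstance, inferInstance, algPM, inferInstance,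
    hMfd, hPfd, ι, Q, hQ, ?_, ?_, hsepPM⟩
  · intro z
    obtain ⟨k, hk⟩ := hPT z.2
    exact ⟨k, Subtype.ext (by simpa using hk)⟩
  · have hyP : y ∈ P := (le_sup_right : K⟮y⟯ ≤ P) (IntermediateField.mem_adjoin_simple_self K y)
    exact ⟨⟨y, hyP⟩, Subtype.ext (by simpa using hy)⟩

/-! ## Transfer of finiteness of integral closures -/

section Transfer

variable {R : Type u} [CommRing R] [IsDomain R] [IsNoetherianRing R]

omit [IsDomain R] in
/-- Finiteness of the integral closure descends along a `K`-embedding `L → M` of extensions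
("As `R` is Noetherian it suffices to show that the integral closure of `R` in `M` is finite").
[cite: StacksProject, Tag 0BI1 (proof of Lemma 10.161.12)] -/
theorem module_finite_integralClosure_of_algHom {K L M : Type u} [Field K] [Field L] [Field M]
    [Algebra K L] [Algebra K M] [Algebra R K] [Algebra R L] [Algebra R M] [IsScalarTower R K L]
    [IsScalarTower R K M] (ι : L →ₐ[K] M) [Module.Finite R (integralClosure R M)] :
    Module.Finite R (integralClosure R L) := by
  let f : integralClosure R L →ₐ[R] integralClosure R M :=
    ((ι.restrictScalars R).comp (integralClosure R L).val).codRestrict (integralClosure R M)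
      fun z => (show IsIntegral R (z : L) from z.2).map (ι.restrictScalars R)
  have hf : Function.Injective f := fun a b h =>
    Subtype.ext (ι.toRingHom.injective (congrArg Subtype.val h :))
  exact Module.Finite.of_injective f.toLinearMap hf

/-- **Separable ascent** (Stacks 10.161.8 + 10.161.12): if the integral closure `R'` of the
Noetherian domain `R` in a finite extension `E` of `Frac R` is finite over `R`, and `M/E` is a
finite separable extension, then the integral closure of `R` in `M` is finite over `R` — it is the
integral closure of the normal Noetherian domain `R'` in the separable extension `M` of
`Frac R' = E`, finite over `R'` by the trace argument (Mathlib's `IsIntegralClosure.finite`).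
[cite: StacksProject, Tag 0BI1 (Lemmas 10.161.8, 10.161.12)] -/
theorem module_finite_integralClosure_of_isSeparable_tower {K E M : Type u} [Field K] [Field E]
    [Field M] [Algebra R K] [IsFractionRing R K] [Algebra K E] [Algebra R E] [IsScalarTower R K E]
    [Algebra E M] [Algebra K M] [IsScalarTower K E M] [Algebra R M] [IsScalarTower R E M]
    [FiniteDimensional K E] [FiniteDimensional K M] [Algebra.IsSeparable E M]
    (hE : Module.Finite R (integralClosure R E)) : Module.Finite R (integralClosure R M) := by
  haveI := hE
  haveI : IsIntegrallyClosed (integralClosure R E) :=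
    integralClosure.isIntegrallyClosedOfFiniteExtension K
  haveI : IsFractionRing (integralClosure R E) E :=
    integralClosure.isFractionRing_of_finite_extension K E
  haveI : IsNoetherianRing (integralClosure R E) :=
    isNoetherian_of_tower R (inferInstance : IsNoetherian R (integralClosure R E))
  haveI : FiniteDimensional E M := Module.Finite.of_restrictScalars_finite K E M
  haveI : Module.Finite (integralClosure R E) (integralClosure (integralClosure R E) M) :=
    IsIntegralClosure.finite (integralClosure R E) E M _
  haveI : Module.Finite R (integralClosure (integralClosure R E) M) :=
    Module.Finite.trans (integralClosure R E) _
  let g : integralClosure R M →ₐ[R] integralClosure (integralClosure R E) M :=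
    (integralClosure R M).val.codRestrict
      ((integralClosure (integralClosure R E) M).restrictScalars R)
      fun z => (show IsIntegral R (z : M) from z.2).tower_top
  have hg : Function.Injective g := fun a b h => Subtype.ext (congrArg Subtype.val h :)
  exact Module.Finite.of_injective g.toLinearMap hg

end Transfer

/-! ## Tate's theorem -/

section Tate

variable {R : Type u} [CommRing R] [IsDomain R] [IsNoetherianRing R] [IsIntegrallyClosed R]

/-- **Tate's theorem** (Stacks 10.161.16 = EGA 0_IV 23.1.3): let `R` be a normal Noetherian domain,
`x ∈ R` non-zero with `xR` prime, `R` complete and separated in the `x`-adic topology, and assume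
`R/xR` is N-2 (spelled out as `hN2`). Then `R` is N-2: for every finite extension `L` of a field
of fractions `K` of `R`, the integral closure of `R` in `L` is a finite `R`-module. Proof as
printed: characteristic `0` by separability; characteristic `p` through the tower
`K ⊆ E ⊆ M ⊇ L` of `exists_purelyInseparable_separable_tower` (with `c = x`), the purely
inseparable core `module_finite_integralClosure_of_pow_mem` for `E`, separable ascent to `M`, and
descent to `L`. [cite: StacksProject, Tag 0BI1 (Lemma 10.161.16)] [cite: EGA0IV, (23.1.3)] -/
theorem module_finite_integralClosure_of_isAdicComplete_span (x : R) (hx0 : x ≠ 0)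
    (hxp : (Ideal.span {x}).IsPrime) [IsAdicComplete (Ideal.span {x}) R]
    (hN2 : ∀ (k₀ E : Type u) [Field k₀] [Field E] [Algebra (R ⧸ Ideal.span {x}) k₀]
      [IsFractionRing (R ⧸ Ideal.span {x}) k₀] [Algebra k₀ E] [Algebra (R ⧸ Ideal.span {x}) E]
      [IsScalarTower (R ⧸ Ideal.span {x}) k₀ E] [FiniteDimensional k₀ E],
      Module.Finite (R ⧸ Ideal.span {x}) (integralClosure (R ⧸ Ideal.span {x}) E))
    (K L : Type u) [Field K] [Field L] [Algebra R K] [IsFractionRing R K] [Algebra K L]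
    [Algebra R L] [IsScalarTower R K L] [FiniteDimensional K L] :
    Module.Finite R (integralClosure R L) := by
  obtain ⟨p, hp⟩ := CharP.exists K
  rcases CharP.char_is_prime_or_zero K p with hpp | hp0
  · -- characteristic `p`
    haveI : Fact p.Prime := ⟨hpp⟩
    obtain ⟨M, E, _, _, _, _, _, _, _, _, ι, Q, hQ, hEQ, ⟨y, hy⟩, hsep⟩ :=
      exists_purelyInseparable_separable_tower K L p (algebraMap R K x)
    letI : Algebra R E := ((algebraMap K E).comp (algebraMap R K)).toAlgebra
    haveI : IsScalarTower R K E := IsScalarTower.of_algebraMap_eq fun r => rfl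
    letI : Algebra R M := ((algebraMap K M).comp (algebraMap R K)).toAlgebra
    haveI : IsScalarTower R K M := IsScalarTower.of_algebraMap_eq fun r => rfl
    haveI : IsScalarTower R E M := IsScalarTower.of_algebraMap_eq fun r => by
      change algebraMap K M (algebraMap R K r) = algebraMap E M (algebraMap K E (algebraMap R K r))
      exact IsScalarTower.algebraMap_apply K E M _
    have hy' : y ^ Q = algebraMap R E x := hy
    have hE : Module.Finite R (integralClosure R E) :=
      module_finite_integralClosure_of_pow_mem x hx0 hxp hN2 hQ hEQ y hy'
    haveI : Module.Finite R (integralClosure R M) :=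
      module_finite_integralClosure_of_isSeparable_tower (K := K) hE
    exact module_finite_integralClosure_of_algHom ι
  · -- characteristic `0`
    subst hp0
    haveI : CharZero K := CharP.charP_to_charZero K
    haveI : Algebra.IsSeparable K L := Algebra.IsAlgebraic.isSeparable_of_perfectField
    exact IsIntegralClosure.finite R K L (integralClosure R L)

end Tate

end Literature.AlgebraicGeometry.Resolution

end
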